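import Mathlib.Data.Nat.Choose.Bounds
import Literature.Combinatorics.Expanders.Concentrator
import Summits.ValiantsHypothesis.ValiantsHypothesis.Theorems.LacunarySymmetroidMatrixDescartesCensusTropicalKLawSlopes

/-!
# Route `KPlusLogSqLaw`, crux `TropicalB` — the window-counting rung in ENTROPY-SHARP form

HONEST FRAMING.  Support file toward the registered stubs `stub_tropThin` / `stub_tropFat` of the crux `TropicalB`
(ledger item `stmt-ValiantsHypothesis-19771`, route `KPlusLogSqLaw`, DRAFT; birth skeleton
`Cruxes/TropicalB/Lines/birth.lean`; cell `pub-symmetroid`, seat val-sym-trop-p4, 2026-08-26).  It proves NEITHER stub: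
every theorem here is slope counting (`tropRootLawAt_slopeCount`, tree) followed by arithmetic, so every format it decides
lies inside Conjecture B's Descartes-known regime (ONBOARD-val-sym §2.4 «T3 honesty»).  Nothing is asserted or
hypothesised about `TropicalB` inside its window, `Lifting`, `KPlusLogSqLaw`, `MatrixDescartes` or `VP ≠ VNP`.

WHAT IT ADDS.  The tree's off-window rung `tropRootLawAt_offWindow` (`K ≤ log₂ m + 1 ∨ m ≤ K ⇒ T(m,K) ≤ 2^{3(K + log₂² m)}`)
uses the crude estimate `C(m+K−1, m) ≤ 2^{m+K−1}` on the fat side and `≤ (K+m−1)^{K−1}` on the thin side.  The true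
shape of slope counting is the ENTROPY bound `C(m+K, K) ≤ (e·(m+K)/K)^K`, i.e. `K·(log₂(m/K) + O(1))` bits — «log₂(m/K) bits
per slope class».  In the kernel (with `3` for `e`, via the tree's `K^K ≤ 3^K·K!`,
`Literature.Combinatorics.Expanders.pow_self_le_three_pow_mul_factorial`):

* `tropRootLawAt_entropy      : TropRootLawAt m K (2 ^ (K * (Nat.log 2 (m / K) + 4)))` for ALL `m, K`;
* `tropRootLawAt_fatCone_log   : m ≤ 2^c · K → TropRootLawAt m K (2 ^ ((c + 4) * K))` — the fat stub's conclusion on the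
  cone `m ≤ 2^c·K` with a constant LOGARITHMIC in the cone's slope (crude counting gives `C = B + 1` on `m ≤ B·K`);
* `tropRootLawAt_thinStrip_lin : K ≤ c · log₂ m → TropRootLawAt m K (2 ^ (5 * c * Nat.log 2 m ^ 2))` — the thin stub's
  conclusion on the strip `K ≤ c·log₂ m` with a constant LINEAR in `c` (crude counting gives `c² + 2c`);
* `tropRootLawAt_offWindow_log : (K ≤ c · log₂ m ∨ m ≤ 2^c · K) → TropRootLawAt m K (2 ^ ((c + 4) * (K + Nat.log 2 m ^ 2)))`
  — the parametrised family of off-window rungs: the tropical `K + log² m` law with constant `c + 4` holds OFF THE WINDOW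
  `c·log₂ m < K < m/2^c`, for every `c` (the tree rung is the member `c ≈ 1`).

READING (docstring only, nothing asserted).  For a FIXED budget constant `C` the formats left undecided by counting are
exactly the deep window `(C−4)·log₂ m < K < m / 2^{C−4}`; `TropicalB` (one absolute `C`) is the statement that some single
`C` also closes this window, whose two ends recede only logarithmically (thin) resp. geometrically (fat) as `C` grows.  In the
window the compression the crux asks for below counting is `log₂(m/K) − C` bits per class — positive throughout
`log₂² m ≤ K ≤ m/2^{C}`, about `½·log₂ m` bits per class at `K = √m`.

[folklore] (binomial entropy bound; the row itself is the cell's definition `TropicalCensus.TropRootLawAt`).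
-/

-- `Summit.ValiantsHypothesis.ValiantsHypothesis.…` repeats a component by the D-0017 layout
-- (single-conjunct summit), which the `dupNamespace` linter flags; the name is mandated.
set_option linter.dupNamespace false
set_option autoImplicit false

namespace Summit.ValiantsHypothesis.ValiantsHypothesis.Theorems.LacunarySymmetroidMatrixDescartes.TropicalCensus

open Summit.ValiantsHypothesis.ValiantsHypothesis.Theorems.MatrixDescartes.Negative

section Entropy

/-! ## 1. Arithmetic: the binomial entropy bound with base `3` (Stirling-type step `K^K ≤ 3^K·K!` from the tree) -/

/-- **Binomial entropy bound, base 3**: `C(m+K, K) · K^K ≤ (3·(m+K))^K`, i.e. `C(m+K,K) ≤ (3(m+K)/K)^K` — from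
`C(n,K) ≤ n^K/K!` (`Nat.choose_le_pow_div`) and the tree's `K^K ≤ 3^K·K!`
(`Literature.Combinatorics.Expanders.pow_self_le_three_pow_mul_factorial`, from `Real.pow_div_factorial_le_exp`). [folklore] -/
theorem choose_mul_pow_self_le_three_mul_pow (m K : ℕ) : (m + K).choose K * K ^ K ≤ (3 * (m + K)) ^ K := by
  have h1 : (((m + K).choose K : ℕ) : ℝ) ≤ ((m + K : ℕ) : ℝ) ^ K / (K.factorial : ℝ) :=
    Nat.choose_le_pow_div K (m + K)
  have h2 : ((K ^ K : ℕ) : ℝ) ≤ ((3 ^ K * K.factorial : ℕ) : ℝ) := by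
    exact_mod_cast Literature.Combinatorics.Expanders.pow_self_le_three_pow_mul_factorial K
  have hf : (0 : ℝ) < (K.factorial : ℝ) := by exact_mod_cast Nat.factorial_pos K
  have h3 : (((m + K).choose K : ℕ) : ℝ) * ((K ^ K : ℕ) : ℝ) ≤ ((3 * (m + K) : ℕ) : ℝ) ^ K := by
    calc (((m + K).choose K : ℕ) : ℝ) * ((K ^ K : ℕ) : ℝ)
        ≤ (((m + K : ℕ) : ℝ) ^ K / (K.factorial : ℝ)) * ((3 ^ K * K.factorial : ℕ) : ℝ) :=
          mul_le_mul h1 h2 (by positivity) (by positivity)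
      _ = (3 : ℝ) ^ K * (((m + K : ℕ) : ℝ) ^ K / (K.factorial : ℝ) * (K.factorial : ℝ)) := by
          push_cast
          ring
      _ = (3 : ℝ) ^ K * ((m + K : ℕ) : ℝ) ^ K := by rw [div_mul_cancel₀ _ hf.ne']
      _ = ((3 * (m + K) : ℕ) : ℝ) ^ K := by push_cast; rw [mul_pow]
  exact_mod_cast h3

/-- Integer-logarithm bookkeeping: `3·(m + K) ≤ K · 2^(⌊log₂ ⌊m/K⌋⌋ + 4)` for `K ≥ 1`
(because `m < K·(⌊m/K⌋ + 1)` and `q + 1 ≤ 2^(⌊log₂ q⌋ + 1)`). [folklore] -/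
theorem three_mul_add_le_mul_two_pow_log (m K : ℕ) (hK : 0 < K) :
    3 * (m + K) ≤ K * 2 ^ (Nat.log 2 (m / K) + 4) := by
  set q := m / K with hq
  have hm : m < K * (q + 1) := hq ▸ Nat.lt_mul_div_succ m hK
  have hq2 : q < 2 ^ (Nat.log 2 q + 1) := Nat.lt_pow_succ_log_self (by norm_num) q
  have h16 : 3 * (q + 2) ≤ 2 ^ (Nat.log 2 q + 4) := by
    have h8 : 2 ^ (Nat.log 2 q + 4) = 8 * 2 ^ (Nat.log 2 q + 1) := by ring
    have h1 : 1 ≤ 2 ^ (Nat.log 2 q + 1) := Nat.one_le_two_pow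
    omega
  calc 3 * (m + K) ≤ 3 * (K * (q + 2)) := by nlinarith
    _ = K * (3 * (q + 2)) := by ring
    _ ≤ K * 2 ^ (Nat.log 2 q + 4) := Nat.mul_le_mul_left _ h16

/-! ## 2. The entropy row -/

/-- **ENTROPY ROW (slope counting in its true shape).**  For all `m, K`: every dominance design of format `(m, K)` has at
most `2^{K·(⌊log₂ ⌊m/K⌋⌋ + 4)}` sign-alternating dominant breakpoints — `log₂(m/K) + 4` bits per slope class.  Proof:
`T + 1 ≤ multichoose K m = C(m+K−1, m) ≤ C(m+K, K) ≤ (3(m+K)/K)^K ≤ (2^{⌊log₂(m/K)⌋+4})^K` (`tropRootLawAt_slopeCount` +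
§1).  At `K = 0` the row is `tropRootLawAt_zero`.  Still COUNTING: no structure of parametric assignment beyond «slopes
strictly increase along the chain» is used. [folklore] -/
theorem tropRootLawAt_entropy (m K : ℕ) : TropRootLawAt m K (2 ^ (K * (Nat.log 2 (m / K) + 4))) := by
  rcases Nat.eq_zero_or_pos K with rfl | hK
  · exact tropRootLawAt_zero m _
  refine tropRootLawAt_mono ?_ (tropRootLawAt_slopeCount m K)
  have h1 : Nat.multichoose K m ≤ (m + K).choose K := by
    rw [Nat.multichoose_eq]
    calc (K + m - 1).choose m ≤ (K + m).choose m := Nat.choose_le_choose m (Nat.sub_le _ _)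
      _ = (m + K).choose K := by rw [Nat.add_comm K m]; exact Nat.choose_symm_add
  have h2 : (m + K).choose K * K ^ K ≤ 2 ^ (K * (Nat.log 2 (m / K) + 4)) * K ^ K := by
    calc (m + K).choose K * K ^ K ≤ (3 * (m + K)) ^ K := choose_mul_pow_self_le_three_mul_pow m K
      _ ≤ (K * 2 ^ (Nat.log 2 (m / K) + 4)) ^ K :=
          Nat.pow_le_pow_left (three_mul_add_le_mul_two_pow_log m K hK) K
      _ = 2 ^ (K * (Nat.log 2 (m / K) + 4)) * K ^ K := by rw [mul_pow, ← pow_mul, mul_comm]; ring_nf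
  have h3 : (m + K).choose K ≤ 2 ^ (K * (Nat.log 2 (m / K) + 4)) :=
    Nat.le_of_mul_le_mul_right h2 (by positivity)
  omega

/-- The bits-per-class exponent is at most `log₂ m + 4` per class: `K·(⌊log₂ ⌊m/K⌋⌋ + 4) ≤ K·(⌊log₂ m⌋ + 4)`. [folklore] -/
theorem tropRootLawAt_entropy_le (m K : ℕ) : TropRootLawAt m K (2 ^ (K * (Nat.log 2 m + 4))) := by
  refine tropRootLawAt_mono (Nat.pow_le_pow_right (by norm_num) (Nat.mul_le_mul_left K ?_)) (tropRootLawAt_entropy m K)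
  exact Nat.add_le_add_right (Nat.log_mono_right (Nat.div_le_self m K)) 4

/-! ## 3. Corollaries in the two stubs' shapes (one constant per range parameter `c`: SUPPORTS, not the stubs) -/

/-- **FAT CONE with logarithmic constant** (toward `stub_tropFat`): on the cone `m ≤ 2^c · K` the fat stub's conclusion
holds with `C = c + 4`: `TropRootLawAt m K (2^{(c+4)·K})`.  (Crude counting `C(m+K−1,m) ≤ 2^{m+K−1}` needs `C = B + 1` on
`m ≤ B·K`; here `B = 2^c`.)  The fat stub itself asks for ONE `C` on all of `log₂² m ≤ K`, i.e. also for `K < m/2^c` for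
every `c` — untouched here. [folklore] -/
theorem tropRootLawAt_fatCone_log (c m K : ℕ) (h : m ≤ 2 ^ c * K) : TropRootLawAt m K (2 ^ ((c + 4) * K)) := by
  rcases Nat.eq_zero_or_pos K with rfl | hK
  · exact tropRootLawAt_zero m _
  refine tropRootLawAt_mono (Nat.pow_le_pow_right (by norm_num) ?_) (tropRootLawAt_entropy m K)
  have hq : m / K ≤ 2 ^ c := Nat.div_le_of_le_mul (by rw [Nat.mul_comm]; exact h)
  have hlog : Nat.log 2 (m / K) ≤ c := by
    calc Nat.log 2 (m / K) ≤ Nat.log 2 (2 ^ c) := Nat.log_mono_right hq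
      _ = c := Nat.log_pow (by norm_num) c
  calc K * (Nat.log 2 (m / K) + 4) ≤ K * (c + 4) := Nat.mul_le_mul_left K (by omega)
    _ = (c + 4) * K := Nat.mul_comm _ _

/-- **THIN STRIP with linear constant** (toward `stub_tropThin`): on the strip `K ≤ c · ⌊log₂ m⌋` the thin stub's
conclusion holds with `C = 5c`: `TropRootLawAt m K (2^{5c·log₂² m})` (from `K·(log₂ m + 4) ≤ c·L·(L + 4) ≤ 5c·L²` for
`L = ⌊log₂ m⌋ ≥ 1`; at `L = 0` the strip is `K = 0`).  Crude counting (`C(m+K−1,m) ≤ (K+m−1)^{K−1}`) needs `c² + 2c`.  The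
thin stub itself asks for ONE `C` on all of `K ≤ log₂² m` — untouched here. [folklore] -/
theorem tropRootLawAt_thinStrip_lin (c m K : ℕ) (h : K ≤ c * Nat.log 2 m) :
    TropRootLawAt m K (2 ^ (5 * c * Nat.log 2 m ^ 2)) := by
  rcases Nat.eq_zero_or_pos K with rfl | hK
  · exact tropRootLawAt_zero m _
  refine tropRootLawAt_mono (Nat.pow_le_pow_right (by norm_num) ?_) (tropRootLawAt_entropy_le m K)
  set L := Nat.log 2 m with hL
  have hL1 : 1 ≤ L := by
    by_contra h0
    have : L = 0 := by omega
    rw [this, Nat.mul_zero] at h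
    omega
  calc K * (L + 4) ≤ c * L * (L + 4) := Nat.mul_le_mul_right _ h
    _ = c * L ^ 2 + 4 * (c * L) := by ring
    _ ≤ c * L ^ 2 + 4 * (c * L) * L := by nlinarith
    _ = 5 * c * L ^ 2 := by ring

/-- **TB OFF THE WINDOW `c·log₂ m < K < m/2^c`, for every `c`** (the parametrised family of off-window rungs; the tree's
`tropRootLawAt_offWindow` is the member at the thin end `K ≤ log₂ m + 1` / fat end `m ≤ K` with `C = 3`): if
`K ≤ c·⌊log₂ m⌋` or `m ≤ 2^c·K` then the tropical `K + log² m` law holds at `(m, K)` with constant `c + 4`.  Thin side: with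
`L = ⌊log₂ m⌋`, `K(L+4) ≤ cL² + 4cL ≤ (c+4)L²` when `L ≥ c`, and `K(L+4) < K(c+4)` when `L < c`.  READING: `TropicalB` ⟺
one absolute `C` also serves every format in the windows `(C−4)·log₂ m < K < m/2^{C−4}`; counting cannot, since there it gives
`K·log₂(m/K)` bits against the budget `C·(K + log₂² m)`. [folklore] -/
theorem tropRootLawAt_offWindow_log (c m K : ℕ) (h : K ≤ c * Nat.log 2 m ∨ m ≤ 2 ^ c * K) :
    TropRootLawAt m K (2 ^ ((c + 4) * (K + Nat.log 2 m ^ 2))) := by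
  rcases h with h | h
  · rcases Nat.eq_zero_or_pos K with rfl | hK
    · exact tropRootLawAt_zero m _
    refine tropRootLawAt_mono (Nat.pow_le_pow_right (by norm_num) ?_) (tropRootLawAt_entropy_le m K)
    set L := Nat.log 2 m with hL
    rcases Nat.lt_or_ge L c with hLc | hcL
    · -- `L < c`: `K(L+4) ≤ K(c+4) ≤ (c+4)(K+L²)`
      calc K * (L + 4) ≤ K * (c + 4) := Nat.mul_le_mul_left _ (by omega)
        _ = (c + 4) * K := Nat.mul_comm _ _
        _ ≤ (c + 4) * (K + L ^ 2) := Nat.mul_le_mul_left _ (Nat.le_add_right _ _)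
    · -- `L ≥ c`: `K(L+4) ≤ cL(L+4) = cL² + 4cL ≤ cL² + 4L² = (c+4)L²`
      calc K * (L + 4) ≤ c * L * (L + 4) := Nat.mul_le_mul_right _ h
        _ = c * L ^ 2 + 4 * (c * L) := by ring
        _ ≤ c * L ^ 2 + 4 * (L * L) := by nlinarith
        _ = (c + 4) * L ^ 2 := by ring
        _ ≤ (c + 4) * (K + L ^ 2) := Nat.mul_le_mul_left _ (Nat.le_add_left _ _)
  · refine tropRootLawAt_mono (Nat.pow_le_pow_right (by norm_num) ?_) (tropRootLawAt_fatCone_log c m K h)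
    exact Nat.mul_le_mul_left _ (Nat.le_add_right _ _)

/-- The same family read in the currency of `TropKPlusLogSqLaw` (`∃ C ∀ m K, TropRootLawAt m K (2^{C(K + log₂² m)})`): for
every `c`, the law WITH CONSTANT `c + 4` holds at every format outside the window `c·log₂ m < K < m/2^c`; equivalently the
candidate law `TropKPlusLogSqLaw` is the assertion that for some single `c` it also holds inside.  Recorded as the
implication «law inside the window with constant `c + 4` ⇒ law everywhere with constant `c + 4`». [folklore] -/
theorem tropKPlusLogSqLaw_of_window (c : ℕ)
    (hwin : ∀ m K : ℕ, c * Nat.log 2 m < K → 2 ^ c * K < m → TropRootLawAt m K (2 ^ ((c + 4) * (K + Nat.log 2 m ^ 2)))) :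
    TropKPlusLogSqLaw := by
  refine ⟨c + 4, fun m K => ?_⟩
  by_cases h1 : K ≤ c * Nat.log 2 m
  · exact tropRootLawAt_offWindow_log c m K (Or.inl h1)
  by_cases h2 : m ≤ 2 ^ c * K
  · exact tropRootLawAt_offWindow_log c m K (Or.inr h2)
  exact hwin m K (by omega) (by omega)

end Entropy

end Summit.ValiantsHypothesis.ValiantsHypothesis.Theorems.LacunarySymmetroidMatrixDescartes.TropicalCensus
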